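import Summits.MatrixMultiplication.MatrixMultiplication.Theorems.SaturationLadderTwinRung
import Summits.MatrixMultiplication.MatrixMultiplication.Theorems.SaturationLadderTwinSaturation
import Literature.Computability.AlgebraicComplexity.RectangularExponentInformationBound
import HarnessLib

/-!
# SaturationLadder — the `SubexpSaturation` clause holds for every `c > log 3` (unconditional)

Route `SaturationLadder` (sub-problem `MatrixMultiplication`), rank-2 crux `SubexpSaturation`
(stmt-MatrixMultiplication-25909): for EVERY `c > 0`, eventually in `t`, the information bound
`ω(1,t,r) ≥ 1 + r` is attained from some `r ≤ e^{c/(1−t)}`.  The landed base-4 rung (`ExpSaturation`,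
Coppersmith–Winograd level 1) gives the clause for `c > log 4`; the twin rung `TwinSaturation`
(`Theorems/SaturationLadderTwinSaturation.lean`, proved) gives it for `c > log 3`:

* `subexpSaturation_clause_above_log_three`: `∀ c > log 3, ∃ t₀ < 1, ∀ t ∈ [t₀,1), ∃ r ∈ [1, e^{c/(1−t)}],
  ω(1, t, r) ≤ 1 + r` — sorry-free, no hypotheses.  This is the quantitative ladder's current rung
  (base `3`; the crux is base `1⁺`), and the BC5 witness of weakness for `SubexpSaturation`.

No named facts, no sorry (cell `decomp-mm`, lens 1, gen 8).
-/

set_option linter.dupNamespace false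
-- (single-conjunct summit: the namespace repeats `MatrixMultiplication`)

noncomputable section

namespace Summit.MatrixMultiplication.MatrixMultiplication.Theorems.SaturationLadderSubexpAboveLogThree

open Literature.Computability.AlgebraicComplexity
open Summit.MatrixMultiplication.MatrixMultiplication.Theorems.SaturationLadderTwinRung
  (subexpSaturation_clause_of_twinSaturation)
open Summit.MatrixMultiplication.MatrixMultiplication.Theorems.SaturationLadderTwinSaturation
  (twinSaturation)

/-- **The `SubexpSaturation` clause for every `c > log 3`, unconditionally**: eventually in `t < 1`
some `r ∈ [1, e^{c/(1−t)}]` attains `ω(1, t, r) ≤ 1 + r`.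
[cite: CoppersmithWinograd1990, §8] [cite: AlmanDuanVassilevskaWilliamsXuXuZhou2025, Thm. 3.2, §3.4] -/
theorem subexpSaturation_clause_above_log_three (c : ℝ) (hc : Real.log 3 < c) :
    ∃ t₀ : ℝ, t₀ < 1 ∧ ∀ t : ℝ, t₀ ≤ t → t < 1 →
      ∃ r : ℝ, 1 ≤ r ∧ r ≤ Real.exp (c / (1 - t)) ∧ omegaRect ℂ 1 t r ≤ 1 + r :=
  subexpSaturation_clause_of_twinSaturation twinSaturation c hc

/-- The same with equality `ω(1, t, r) = 1 + r` (the information lower bound `1 + r ≤ ω(1,t,r)`).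
[cite: HuangPan1998, (2.8)] -/
theorem saturation_eq_above_log_three (c : ℝ) (hc : Real.log 3 < c) :
    ∃ t₀ : ℝ, t₀ < 1 ∧ ∀ t : ℝ, t₀ ≤ t → t < 1 →
      ∃ r : ℝ, 1 ≤ r ∧ r ≤ Real.exp (c / (1 - t)) ∧ omegaRect ℂ 1 t r = 1 + r := by
  obtain ⟨t₀, ht₀, H⟩ := subexpSaturation_clause_above_log_three c hc
  refine ⟨t₀, ht₀, fun t ht ht1 => ?_⟩
  obtain ⟨r, hr1, hr, hω⟩ := H t ht ht1
  exact ⟨r, hr1, hr, le_antisymm hω (add_le_omegaRect₁₃ ℂ 1 t r)⟩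

end Summit.MatrixMultiplication.MatrixMultiplication.Theorems.SaturationLadderSubexpAboveLogThree

end
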